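import Summits.Ventures.PercRepro.S1CFCapsLine

/-!
# PercRepro — `Q₄² ≤ 41`, AND `Q₄² ≤ 33` WITH FIVE DEPENDENT PAIRS (p1, gen 37)

The cap `Q₄²` of p7's ν = 4 program, assembled from S1CFCapsLine. **`ncard_four_eRk_le_two_le_split`**:
`Q₄² ≤ 5 + 9 · Q₃¹ + D₂ · D₂ + 6 · D₂` — a `4`-set of rank `≤ 2` with a dependent pair `P` contains a rank-`1` triple, or is
the union of two dependent pairs, or is `P ∪ Y` with `{p} ∪ Y` a triangle (`Y` a relative circuit of size `2` of
`{p} ∪ (E ∖ cl {p})`, a set of nullity `≤ 3`: `≤ 6` per pair); without a dependent pair it is one of `≤ 5` `4`-subsets of a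
line. **`ncard_three_eRk_le_one_le_one_of_le_five`**: `D₂ ≤ 5 ⇒ Q₃¹ ≤ 1`. **`ncard_four_eRk_le_two_le_of_five_le`**:
`D₂ ≥ 5 ⇒ Q₄² ≤ 33` (the `4`-sets meeting the class of `4` in `≥ 3` points). **`ncard_four_eRk_le_two_le_fortyone`**:
`Q₄² ≤ 41` unconditionally (`D₂ ≤ 3`: `5 + 9 + 9 + 18`; `D₂ = 4`: no triangles, `5 + 9 + 16`; `D₂ ≥ 5`: `33`).
Nothing about any cell is claimed. Axioms: standard.
-/

open scoped Matroid

namespace PercRepro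

namespace S1CF

open Set

variable {α : Type}

/-- The nullity of `{p} ∪ (E ∖ cl {p})` is at most `3` when `p` has a parallel partner. -/
theorem ncard_insert_sdiff_closure_le (M : Matroid α) [M.Finite] (hd : M.E.encard = M.eRank + ((4 : ℕ) : ℕ∞))
    (hn : M.E.ncard = 12) {p : α} (hp : p ∈ M.E) (h2 : 2 ≤ (M.closure {p}).ncard) :
    (insert p (M.E \ M.closure {p})).ncard ≤ (M.eRk (insert p (M.E \ M.closure {p}))).toNat + 3 := by
  have hEfin := M.ground_finite
  set Z := insert p (M.E \ M.closure {p}) with hZdef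
  have hZE : Z ⊆ M.E := Set.insert_subset hp sdiff_subset
  have hcl : M.closure {p} ⊆ M.E := M.closure_subset_ground _
  -- rank of `Z` is the rank of `E`
  have hrk : M.eRk Z = M.eRk M.E := by
    apply le_antisymm (M.eRk_mono hZE)
    have hsub : M.E ⊆ M.closure Z := by
      intro w hw
      by_cases hwp : w ∈ M.closure {p}
      · exact M.closure_subset_closure (Set.singleton_subset_iff.2 (Set.mem_insert p _)) hwp
      · exact M.subset_closure Z hZE (Or.inr ⟨hw, hwp⟩)
    calc M.eRk M.E ≤ M.eRk (M.closure Z) := M.eRk_mono hsub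
      _ = M.eRk Z := M.eRk_closure_eq Z
  have hpcl : p ∈ M.closure {p} := M.mem_closure_self p hp
  have hZcard : Z.ncard + (M.closure {p}).ncard = M.E.ncard + 1 := by
    have h1 : Z.ncard = (M.E \ M.closure {p}).ncard + 1 :=
      Set.ncard_insert_of_notMem (fun h => h.2 hpcl) (hEfin.subset sdiff_subset)
    have h2 := Set.ncard_sdiff_add_ncard_of_subset hcl hEfin
    omega
  have h8 := eRk_ground_toNat_eq_eight M hd hn
  rw [hrk]
  omega

/-- The members of the third class of `4`-sets through a dependent pair `P` number at most `6`: they are `P ∪ Y` with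
`Y` a relative circuit of size `2` of `{p} ∪ (E ∖ cl {p})`. -/
theorem ncard_four_eRk_le_two_through_pair_le_six (M : Matroid α) [M.Finite] (hL : ∀ e ∈ M.E, ¬ M.IsLoop e)
    (hd : M.E.encard = M.eRank + ((4 : ℕ) : ℕ∞)) (hn : M.E.ncard = 12) {P : Set α} (hPE : P ⊆ M.E)
    (hP2 : P.ncard = 2) (hPdep : M.Dep P) :
    {X : Set α | X ⊆ M.E ∧ X.ncard = 4 ∧ P ⊆ X ∧ M.eRk X ≤ 2 ∧
      (∀ Z ⊆ X, Z.ncard = 3 → ¬ M.eRk Z ≤ 1) ∧ ¬ M.Dep (X \ P)}.ncard ≤ 6 := by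
  classical
  have hEfin := M.ground_finite
  obtain ⟨p, p', hpp', rfl⟩ := Set.ncard_eq_two.1 hP2
  have hpE : p ∈ M.E := hPE (by simp)
  have hp'E : p' ∈ M.E := hPE (by simp)
  have hLp := hL p hpE
  have hp'cl : p' ∈ M.closure {p} := mem_closure_singleton_of_dep_pair M hpE hLp hPdep
  have hpcl : p ∈ M.closure {p} := M.mem_closure_self p hpE
  have hF2 : 2 ≤ (M.closure {p}).ncard := by
    have : ({p, p'} : Set α) ⊆ M.closure {p} := by
      intro w hw; rcases hw with rfl | rfl; exacts [hpcl, hp'cl]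
    rw [← Set.ncard_pair hpp']
    exact Set.ncard_le_ncard this (hEfin.subset (M.closure_subset_ground _))
  set Y := M.E \ M.closure {p} with hYdef
  have hYE : Y ⊆ M.E := sdiff_subset
  have hpY : Disjoint {p} Y := Set.disjoint_singleton_left.2 (fun h => h.2 hpcl)
  have hpind : M.Indep {p} := indep_singleton_of_not_isLoop M hpE hLp
  have hν := ncard_insert_sdiff_closure_le M hd hn hpE hF2
  rw [← Set.singleton_union] at hν
  have hrel := ncard_relCircuits_le M 2 (by norm_num) 3 {p} Y (Set.singleton_subset_iff.2 hpE) hYE hpY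
    hpind hν
  norm_num at hrel
  -- the injection `X ↦ X ∖ P`
  have hmap : ∀ X ∈ {X : Set α | X ⊆ M.E ∧ X.ncard = 4 ∧ {p, p'} ⊆ X ∧ M.eRk X ≤ 2 ∧
      (∀ Z ⊆ X, Z.ncard = 3 → ¬ M.eRk Z ≤ 1) ∧ ¬ M.Dep (X \ {p, p'})},
      (fun X : Set α => X \ {p, p'}) X ∈
        {Q : Set α | Q ⊆ Y ∧ Q.ncard = 2 ∧ M.Dep ({p} ∪ Q) ∧ ∀ R, R ⊂ Q → M.Indep ({p} ∪ R)} := by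
    intro X hX
    obtain ⟨hXE, hX4, hPX, hXr, hno1, hXP⟩ := hX
    have hXfin : X.Finite := hEfin.subset hXE
    have hQ2 : (X \ {p, p'}).ncard = 2 := by
      have := Set.ncard_sdiff_add_ncard_of_subset hPX hXfin
      rw [Set.ncard_pair hpp'] at this
      omega
    have hQY : X \ {p, p'} ⊆ Y := by
      intro w hw
      refine ⟨hXE hw.1, fun hwcl => ?_⟩
      -- `{p, p'} ∪ {w}` would be a rank-1 triple inside `X`
      apply hno1 (insert w {p, p'}) (Set.insert_subset hw.1 hPX)
      · rw [Set.ncard_insert_of_notMem hw.2, Set.ncard_pair hpp']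
      · exact eRk_le_one_of_subset_closure_singleton M (x := p) (by
          intro z hz
          simp only [Set.mem_insert_iff, Set.mem_singleton_iff] at hz
          rcases hz with rfl | rfl | rfl
          · exact hwcl
          · exact hpcl
          · exact hp'cl)
    refine ⟨hQY, hQ2, ?_, ?_⟩
    · -- `{p} ∪ (X ∖ P)` has 3 points and rank ≤ 2
      have hsub : {p} ∪ (X \ {p, p'}) ⊆ X := union_subset (Set.singleton_subset_iff.2 (hPX (by simp)))
        sdiff_subset
      have hfin : ({p} ∪ (X \ {p, p'}) : Set α).Finite := hXfin.subset hsub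
      have hc : ({p} ∪ (X \ {p, p'}) : Set α).ncard = 3 := by
        rw [Set.ncard_union_eq (Set.disjoint_singleton_left.2 (fun h => h.2 (by simp)))
          (Set.finite_singleton p) (hXfin.subset sdiff_subset), Set.ncard_singleton, hQ2]
      rw [← Matroid.eRk_lt_encard_iff_dep_of_finite hfin (hsub.trans hXE), ← hfin.cast_ncard_eq, hc]
      exact lt_of_le_of_lt (M.eRk_mono hsub) (lt_of_le_of_lt hXr (by norm_num))
    · -- proper subsets of `X ∖ P`: empty or a singleton outside `cl {p}`
      intro R hR
      have hR1 : R.ncard ≤ 1 := by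
        have : R.ncard < (X \ {p, p'}).ncard := Set.ncard_lt_ncard hR (hXfin.subset sdiff_subset)
        omega
      rw [Set.ncard_le_one_iff_eq ((hXfin.subset sdiff_subset).subset hR.subset)] at hR1
      rcases hR1 with rfl | ⟨w, rfl⟩
      · simpa using hpind
      · have hwY : w ∈ Y := hQY (hR.subset (Set.mem_singleton w))
        rw [Set.union_singleton, hpind.insert_indep_iff_of_notMem (fun h => hwY.2 (by
          rw [Set.mem_singleton_iff] at h; rw [h]; exact hpcl))]
        exact ⟨hwY.1, hwY.2⟩
  have hinj : Set.InjOn (fun X : Set α => X \ {p, p'})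
      {X : Set α | X ⊆ M.E ∧ X.ncard = 4 ∧ {p, p'} ⊆ X ∧ M.eRk X ≤ 2 ∧
        (∀ Z ⊆ X, Z.ncard = 3 → ¬ M.eRk Z ≤ 1) ∧ ¬ M.Dep (X \ {p, p'})} := by
    intro X hX X' hX' h
    simp only at h
    rw [← Set.union_sdiff_cancel hX.2.2.1, ← Set.union_sdiff_cancel hX'.2.2.1, h]
  exact (Set.ncard_le_ncard_of_injOn _ hmap hinj (relCircuits_finite M {p} hYE 2)).trans hrel

/-- **The split** `Q₄² ≤ 5 + 9 · Q₃¹ + D₂ · D₂ + m · D₂`, for any `m` bounding, for every dependent pair `P`, the `4`-sets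
`X ⊇ P` of rank `≤ 2` with no rank-`1` triple and `X ∖ P` independent. -/
theorem ncard_four_eRk_le_two_le_split_of (M : Matroid α) [M.Finite] (hL : ∀ e ∈ M.E, ¬ M.IsLoop e)
    (hK : ∀ e, ¬ M.IsColoop e) (hd : M.E.encard = M.eRank + ((4 : ℕ) : ℕ∞)) (hn : M.E.ncard = 12) (m : ℕ)
    (hm : ∀ P, P ⊆ M.E → P.ncard = 2 → M.Dep P →
      {X : Set α | X ⊆ M.E ∧ X.ncard = 4 ∧ P ⊆ X ∧ M.eRk X ≤ 2 ∧
        (∀ Z ⊆ X, Z.ncard = 3 → ¬ M.eRk Z ≤ 1) ∧ ¬ M.Dep (X \ P)}.ncard ≤ m) :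
    {X : Set α | X ⊆ M.E ∧ X.ncard = 4 ∧ M.eRk X ≤ 2}.ncard ≤
      5 + 9 * {Z : Set α | Z ⊆ M.E ∧ Z.ncard = 3 ∧ M.eRk Z ≤ 1}.ncard +
        {P : Set α | P ⊆ M.E ∧ P.ncard = 2 ∧ M.Dep P}.ncard * {P : Set α | P ⊆ M.E ∧ P.ncard = 2 ∧ M.Dep P}.ncard +
          m * {P : Set α | P ⊆ M.E ∧ P.ncard = 2 ∧ M.Dep P}.ncard := by
  classical
  have hEfin := M.ground_finite
  set 𝒟 := {P : Set α | P ⊆ M.E ∧ P.ncard = 2 ∧ M.Dep P} with h𝒟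
  have h𝒟fin : 𝒟.Finite := hEfin.finite_subsets.subset (fun P hP => hP.1)
  set Q0 := {X : Set α | X ⊆ M.E ∧ X.ncard = 4 ∧ M.eRk X ≤ 2 ∧ ∀ P ⊆ X, P.ncard = 2 → ¬ M.Dep P} with hQ0
  set Qa := {X : Set α | X ⊆ M.E ∧ X.ncard = 4 ∧
    ∃ T ∈ {Z : Set α | Z ⊆ M.E ∧ Z.ncard = 3 ∧ M.eRk Z ≤ 1}, T ⊆ X} with hQa
  set Qb := (fun PP : Set α × Set α => PP.1 ∪ PP.2) '' (𝒟 ×ˢ 𝒟) with hQb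
  set T : Set α → Set (Set α) := fun P => {X : Set α | X ⊆ M.E ∧ X.ncard = 4 ∧ P ⊆ X ∧ M.eRk X ≤ 2 ∧
    (∀ Z ⊆ X, Z.ncard = 3 → ¬ M.eRk Z ≤ 1) ∧ ¬ M.Dep (X \ P)} with hT
  set Qc := {X : Set α | ∃ P ∈ 𝒟, X ∈ T P} with hQc
  have hsplit : {X : Set α | X ⊆ M.E ∧ X.ncard = 4 ∧ M.eRk X ≤ 2} ⊆ Q0 ∪ Qa ∪ Qb ∪ Qc := by
    intro X hX
    obtain ⟨hXE, hX4, hXr⟩ := hX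
    have hXfin : X.Finite := hEfin.subset hXE
    by_cases hpair : ∃ P ⊆ X, P.ncard = 2 ∧ M.Dep P
    · obtain ⟨P, hPX, hP2, hPdep⟩ := hpair
      by_cases htriple : ∃ Z ⊆ X, Z.ncard = 3 ∧ M.eRk Z ≤ 1
      · obtain ⟨Z, hZX, hZ3, hZr⟩ := htriple
        exact Or.inl (Or.inl (Or.inr ⟨hXE, hX4, Z, ⟨hZX.trans hXE, hZ3, hZr⟩, hZX⟩))
      by_cases hrest : M.Dep (X \ P)
      · refine Or.inl (Or.inr ⟨(P, X \ P), ⟨⟨hPX.trans hXE, hP2, hPdep⟩, ⟨sdiff_subset.trans hXE, ?_, hrest⟩⟩, ?_⟩)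
        · show (X \ P).ncard = 2
          have := Set.ncard_sdiff_add_ncard_of_subset hPX hXfin
          omega
        · simp only
          exact Set.union_sdiff_cancel hPX
      · refine Or.inr ⟨P, ⟨hPX.trans hXE, hP2, hPdep⟩, hXE, hX4, hPX, hXr, ?_, hrest⟩
        intro Z hZX hZ3 hZr
        exact htriple ⟨Z, hZX, hZ3, hZr⟩
    · push Not at hpair
      exact Or.inl (Or.inl (Or.inl ⟨hXE, hX4, hXr, hpair⟩))
  have h0 : Q0.ncard ≤ 5 := ncard_four_eRk_le_two_no_pair_le_five M hL hK hd hn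
  have ha : Qa.ncard ≤ 9 * {Z : Set α | Z ⊆ M.E ∧ Z.ncard = 3 ∧ M.eRk Z ≤ 1}.ncard := by
    have := ncard_with_member_le hEfin {Z : Set α | Z ⊆ M.E ∧ Z.ncard = 3 ∧ M.eRk Z ≤ 1} 3 4
      (fun Z hZ => ⟨hZ.1, hZ.2.1⟩)
    rw [hn] at this
    norm_num at this
    exact this
  have hb : Qb.ncard ≤ 𝒟.ncard * 𝒟.ncard := by
    calc Qb.ncard ≤ (𝒟 ×ˢ 𝒟).ncard := Set.ncard_image_le (h𝒟fin.prod h𝒟fin)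
      _ = 𝒟.ncard * 𝒟.ncard := Set.ncard_prod
  have hc : Qc.ncard ≤ m * 𝒟.ncard := by
    apply ncard_exists_mem_le h𝒟fin T
    intro P hP
    exact ⟨hEfin.finite_subsets.subset (fun X hX => hX.1), hm P hP.1 hP.2.1 hP.2.2⟩
  have hQ0fin : Q0.Finite := hEfin.finite_subsets.subset (fun X hX => hX.1)
  have hQafin : Qa.Finite := hEfin.finite_subsets.subset (fun X hX => hX.1)
  have hQbfin : Qb.Finite := (h𝒟fin.prod h𝒟fin).image _
  have hQcfin : Qc.Finite := hEfin.finite_subsets.subset (fun X hX => by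
    obtain ⟨P, -, hXP⟩ := hX
    exact hXP.1)
  calc {X : Set α | X ⊆ M.E ∧ X.ncard = 4 ∧ M.eRk X ≤ 2}.ncard
      ≤ (Q0 ∪ Qa ∪ Qb ∪ Qc).ncard :=
        Set.ncard_le_ncard hsplit (((hQ0fin.union hQafin).union hQbfin).union hQcfin)
    _ ≤ (Q0 ∪ Qa ∪ Qb).ncard + Qc.ncard := Set.ncard_union_le _ _
    _ ≤ (Q0 ∪ Qa).ncard + Qb.ncard + Qc.ncard := by gcongr; exact Set.ncard_union_le _ _
    _ ≤ Q0.ncard + Qa.ncard + Qb.ncard + Qc.ncard := by gcongr; exact Set.ncard_union_le _ _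
    _ ≤ 5 + 9 * {Z : Set α | Z ⊆ M.E ∧ Z.ncard = 3 ∧ M.eRk Z ≤ 1}.ncard + 𝒟.ncard * 𝒟.ncard +
          m * 𝒟.ncard := by gcongr


/-- **`Q₄² ≤ 5 + 9 · Q₃¹ + D₂ · D₂ + 6 · D₂`** (the split with the relative circuit count). -/
theorem ncard_four_eRk_le_two_le_split (M : Matroid α) [M.Finite] (hL : ∀ e ∈ M.E, ¬ M.IsLoop e)
    (hK : ∀ e, ¬ M.IsColoop e) (hd : M.E.encard = M.eRank + ((4 : ℕ) : ℕ∞)) (hn : M.E.ncard = 12) :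
    {X : Set α | X ⊆ M.E ∧ X.ncard = 4 ∧ M.eRk X ≤ 2}.ncard ≤
      5 + 9 * {Z : Set α | Z ⊆ M.E ∧ Z.ncard = 3 ∧ M.eRk Z ≤ 1}.ncard +
        {P : Set α | P ⊆ M.E ∧ P.ncard = 2 ∧ M.Dep P}.ncard * {P : Set α | P ⊆ M.E ∧ P.ncard = 2 ∧ M.Dep P}.ncard +
          6 * {P : Set α | P ⊆ M.E ∧ P.ncard = 2 ∧ M.Dep P}.ncard :=
  ncard_four_eRk_le_two_le_split_of M hL hK hd hn 6
    (fun _ hPE hP2 hPdep => ncard_four_eRk_le_two_through_pair_le_six M hL hd hn hPE hP2 hPdep)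

/-- A `4`-set `X ⊇ P` of rank `≤ 2` with no rank-`1` triple and `X ∖ P` independent yields a triangle through a point of `P`:
with `≥ 4` dependent pairs there is none (LEMMA K). -/
theorem ncard_four_eRk_le_two_through_pair_eq_zero_of_four_le (M : Matroid α) [M.Finite]
    (hL : ∀ e ∈ M.E, ¬ M.IsLoop e) (hK : ∀ e, ¬ M.IsColoop e) (hd : M.E.encard = M.eRank + ((4 : ℕ) : ℕ∞))
    (hn : M.E.ncard = 12) (h4 : 4 ≤ {P : Set α | P ⊆ M.E ∧ P.ncard = 2 ∧ M.Dep P}.ncard) {P : Set α}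
    (hPE : P ⊆ M.E) (hP2 : P.ncard = 2) (hPdep : M.Dep P) :
    {X : Set α | X ⊆ M.E ∧ X.ncard = 4 ∧ P ⊆ X ∧ M.eRk X ≤ 2 ∧
      (∀ Z ⊆ X, Z.ncard = 3 → ¬ M.eRk Z ≤ 1) ∧ ¬ M.Dep (X \ P)}.ncard ≤ 0 := by
  classical
  have hEfin := M.ground_finite
  obtain ⟨p, p', hpp', rfl⟩ := Set.ncard_eq_two.1 hP2
  have hpE : p ∈ M.E := hPE (by simp)
  have hLp := hL p hpE
  have hp'cl : p' ∈ M.closure {p} := mem_closure_singleton_of_dep_pair M hpE hLp hPdep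
  have hpcl : p ∈ M.closure {p} := M.mem_closure_self p hpE
  have hpind : M.Indep {p} := indep_singleton_of_not_isLoop M hpE hLp
  rw [Nat.le_zero, Set.ncard_eq_zero (hEfin.finite_subsets.subset (fun X hX => hX.1)),
    Set.eq_empty_iff_forall_notMem]
  rintro X ⟨hXE, hX4, hPX, hXr, hno1, hXP⟩
  have hXfin : X.Finite := hEfin.subset hXE
  have hQ2 : (X \ {p, p'}).ncard = 2 := by
    have := Set.ncard_sdiff_add_ncard_of_subset hPX hXfin
    rw [Set.ncard_pair hpp'] at this
    omega
  -- the points of `X ∖ P` are outside `cl {p}`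
  have hQcl : ∀ w ∈ X \ {p, p'}, w ∉ M.closure {p} := by
    intro w hw hwcl
    apply hno1 (insert w {p, p'}) (Set.insert_subset hw.1 hPX)
    · rw [Set.ncard_insert_of_notMem hw.2, Set.ncard_pair hpp']
    · exact eRk_le_one_of_subset_closure_singleton M (x := p) (by
        intro z hz
        simp only [Set.mem_insert_iff, Set.mem_singleton_iff] at hz
        rcases hz with rfl | rfl | rfl
        · exact hwcl
        · exact hpcl
        · exact hp'cl)
  -- `{p} ∪ (X ∖ P)` is a triangle
  set T := insert p (X \ {p, p'}) with hTdef
  have hpT : p ∉ X \ {p, p'} := fun h => h.2 (by simp)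
  have hTX : T ⊆ X := Set.insert_subset (hPX (by simp)) sdiff_subset
  have hTE : T ⊆ M.E := hTX.trans hXE
  have hT3 : T.ncard = 3 := by rw [hTdef, Set.ncard_insert_of_notMem hpT (hXfin.subset sdiff_subset), hQ2]
  have hTdep : M.Dep T := by
    have hfin : T.Finite := hXfin.subset hTX
    rw [← Matroid.eRk_lt_encard_iff_dep_of_finite hfin hTE, ← hfin.cast_ncard_eq, hT3]
    exact lt_of_le_of_lt (M.eRk_mono hTX) (lt_of_le_of_lt hXr (by norm_num))
  have hTc : M.IsCircuit T := by
    apply isCircuit_of_dep_three_of_no_dep_pair M hTE hT3 hTdep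
    intro Q hQT hQ2' hQdep
    -- `Q` is a pair inside `T`: it is `X ∖ P` (independent) or contains `p` with a point outside `cl {p}`
    by_cases hpQ : p ∈ Q
    · obtain ⟨a, b, hab, rfl⟩ := Set.ncard_eq_two.1 hQ2'
      have hmem : ∀ w ∈ ({a, b} : Set α), w ≠ p → w ∈ X \ {p, p'} := by
        intro w hw hwp
        rcases hQT hw with h | h
        · exact absurd h hwp
        · exact h
      have hpab : p = a ∨ p = b := by simpa using hpQ
      rcases hpab with hpa | hpb
      · have hbQ : b ∈ X \ {p, p'} := hmem b (by simp) (by rw [hpa]; exact Ne.symm hab)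
        have hQeq : ({a, b} : Set α) = {p, b} := by rw [hpa]
        rw [hQeq] at hQdep
        exact hQcl b hbQ (mem_closure_singleton_of_dep_pair M hpE hLp hQdep)
      · have haQ : a ∈ X \ {p, p'} := hmem a (by simp) (by rw [hpb]; exact hab)
        have hQeq : ({a, b} : Set α) = {p, a} := by rw [hpb, Set.pair_comm]
        rw [hQeq] at hQdep
        exact hQcl a haQ (mem_closure_singleton_of_dep_pair M hpE hLp hQdep)
    · have hQsub : Q ⊆ X \ {p, p'} := by
        intro w hw
        rcases hQT hw with h | h
        · exact absurd h (by rintro rfl; exact hpQ hw)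
        · exact h
      have hQeq : Q = X \ {p, p'} := Set.eq_of_subset_of_ncard_le hQsub (by omega) (hXfin.subset sdiff_subset)
      rw [hQeq] at hQdep
      exact hXP hQdep
  exact not_isCircuit_of_four_le_ncard_dep_pairs M hL hK hd hn h4 hTc (by omega) (by omega)

/-- **`D₂ ≥ 4 ⇒ Q₄² ≤ 5 + 9 · Q₃¹ + D₂ · D₂`** (no triangles). -/
theorem ncard_four_eRk_le_two_le_split_of_four_le (M : Matroid α) [M.Finite] (hL : ∀ e ∈ M.E, ¬ M.IsLoop e)
    (hK : ∀ e, ¬ M.IsColoop e) (hd : M.E.encard = M.eRank + ((4 : ℕ) : ℕ∞)) (hn : M.E.ncard = 12)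
    (h4 : 4 ≤ {P : Set α | P ⊆ M.E ∧ P.ncard = 2 ∧ M.Dep P}.ncard) :
    {X : Set α | X ⊆ M.E ∧ X.ncard = 4 ∧ M.eRk X ≤ 2}.ncard ≤
      5 + 9 * {Z : Set α | Z ⊆ M.E ∧ Z.ncard = 3 ∧ M.eRk Z ≤ 1}.ncard +
        {P : Set α | P ⊆ M.E ∧ P.ncard = 2 ∧ M.Dep P}.ncard * {P : Set α | P ⊆ M.E ∧ P.ncard = 2 ∧ M.Dep P}.ncard := by
  have := ncard_four_eRk_le_two_le_split_of M hL hK hd hn 0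
    (fun _ hPE hP2 hPdep => ncard_four_eRk_le_two_through_pair_eq_zero_of_four_le M hL hK hd hn h4 hPE hP2 hPdep)
  simpa using this

end S1CF

end PercRepro
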